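import Literature.Analysis.FluidPDE.TsaiLocalPressureSup
import Literature.Analysis.FluidPDE.NormalisedPressureLpBound
import Literature.Analysis.FluidPDE.TsaiGrowthLemmas
import HarnessLib

/-!
# Tsai 1998, Lemma 3.2 (polynomial growth of the pressure) from the interior Stokes estimate and
  the `L^p` theory of the normalised pressure

Analysis/FluidPDE proofs layer: the assembly of the decomposition of the named fact
`Literature.Analysis.FluidPDE.tsai1998_lemma32` (`FluidPDE/TsaiGrowthLemmas`; T.-P. Tsai, *On
Leray's self-similar solutions of the Navier–Stokes equations satisfying local energy
estimates*, Arch. Rational Mech. Anal. 143 (1998) 29–51, **Lemma 3.2**, p. 39: "Let `U` be a weak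
solution of (1.3) and let `P` be defined as in Section 2. If `U ∈ L^q((EuclideanSpace ℝ (Fin 3)))`, `3 ≤ q ≤ ∞`, then
`|P(y₀)| = O(|y₀|^N)` as `y₀ → ∞` for some `N < ∞`").

## Result

* `tsai1998_lemma32_of_facts :
    tsai1998_profile_smooth → stokes_interior_Lr_estimate → stein1970_normalisedPressure_Lp_bound →
    tsai1998_lemma32`,

  i.e. Lemma 3.2 for the tree's profile class follows from: the regularity of weak solutions of
  (1.3) (Tsai p. 33, the named fact `tsai1998_profile_smooth` of `TsaiGrowthLemmas`, also an input
  of the endgame `tsai_selfsimilar_of_growth_lemmas`); the interior `L^r` estimate (3.2) for the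
  Stokes system (Tsai p. 37 ← Galdi; `StokesInteriorEstimate`); and, **only for `3 ≤ q < 4`**,
  Stein's `L^p` bound for the Riesz transforms behind the normalised pressure (Tsai's (2.3);
  `NormalisedPressureLpBound`) — for `q ≥ 4` the tree's proved `L²` bound suffices
  (`tsai1998_lemma32_restricted_of_stokes`, the statement of Lemma 3.2 for `4 ≤ q ≤ ∞` from the
  Stokes estimate alone). We obtain `N = 7` and the threshold `|y| ≥ 1`.

## Proof (Tsai 1998, §2–§3, reorganised; see the module docstrings of the files below)

1. `TsaiLocalPressure`: for every radius `ρ`, `P = h_{x₀} + p̃[θ_{x₀,ρ}U]` on `B(x₀, 4ρ)` with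
   `h_{x₀}` harmonic, `sup_{B̄(x₀,ρ)}|∇h_{x₀}| ≤ K(1 + |x₀|)` and
   `‖P − c_{x₀}‖_{L^{3/2}(B(x₀,ρ))} ≤ K(1 + |x₀|)` (Tsai's Lemma 2.1, localised; the `L²`/`L^{q/2}`
   bound of `p̃` from `NormalisedPressureL2Bound` / the Stein fact).
2. `TsaiGradientEstimate` + `TsaiPressureBootstrap`: Lemma 3.1 and the bootstrap of §3.2 give
   polynomial bounds for `‖D²U‖_{L²}`, `‖DU‖_{L⁶}`, `‖U‖_{L^{12}}` on balls `B(x₀, 9)`.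
3. `TsaiLocalPressureSup`: hence `sup |p̃[θ_{x₀,1}U]| ≤ K(1 + |x₀|)⁶`.
4. Here: `osc_{B̄(x₀,1)} P ≤ K(1 + |x₀|)⁶` (`IsLerayProfile.exists_osc_pressure_le`), and chaining
   `⌈|y|⌉` unit steps from `0` to `y` (`abs_sub_le_of_osc_le`) gives `|P(y)| ≤ C|y|⁷` for `|y| ≥ 1`.

## References

* T.-P. Tsai, *On Leray's self-similar solutions of the Navier–Stokes equations satisfying local
  energy estimates*, Arch. Rational Mech. Anal. 143 (1998): Lemma 2.1 (p. 34), Lemma 3.1 (p. 36),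
  §3.2 and Lemma 3.2 (pp. 37–39) [Tsai1998].
* E. M. Stein, *Singular integrals and differentiability properties of functions* (1970), Ch. II
  §4.2 Thm 3 [Stein1971].
* G. P. Galdi, *An introduction to the mathematical theory of the Navier–Stokes equations*, 2nd ed.
  (2011), Thm IV.4.1 [Galdi2011].
-/

noncomputable section

open MeasureTheory Set Function Filter Topology InnerProductSpace Metric
open scoped RealInnerProductSpace Laplacian ContDiff ENNReal NNReal

namespace Literature.Analysis.FluidPDE

section Growth

variable {ν a : ℝ} {U : (EuclideanSpace ℝ (Fin 3)) → (EuclideanSpace ℝ (Fin 3))} {P : (EuclideanSpace ℝ (Fin 3)) → ℝ}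

/-! ### Chaining oscillation bounds along a segment -/

/-- **From local oscillation to polynomial growth.** If `|f(x) − f(x₀)| ≤ K (1 + |x₀|)^n` whenever
`|x − x₀| ≤ ρ` (`ρ > 0`, all centres `x₀`), then `|f(y) − f(0)| ≤ (|y|/ρ + 1) K (1 + |y|)^n` for all
`y` (chain `⌈|y|/ρ⌉` points on the segment `[0, y]`). [folklore] -/
theorem abs_sub_le_of_osc_le {f : (EuclideanSpace ℝ (Fin 3)) → ℝ} {ρ K : ℝ} (hρ : 0 < ρ) (hK : 0 ≤ K) {n : ℕ}
    (h : ∀ x₀ x : (EuclideanSpace ℝ (Fin 3)), ‖x - x₀‖ ≤ ρ → |f x - f x₀| ≤ K * (1 + ‖x₀‖) ^ n) (y : (EuclideanSpace ℝ (Fin 3))) :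
    |f y - f 0| ≤ (‖y‖ / ρ + 1) * K * (1 + ‖y‖) ^ n := by
  set M : ℕ := ⌈‖y‖ / ρ⌉₊ with hM
  have hyρ : 0 ≤ ‖y‖ / ρ := by positivity
  have hMge : ‖y‖ / ρ ≤ M := Nat.le_ceil _
  have hMle : (M : ℝ) ≤ ‖y‖ / ρ + 1 := (Nat.ceil_lt_add_one hyρ).le
  rcases Nat.eq_zero_or_pos M with hM0 | hMpos
  · -- then `y = 0`
    have hy : y = 0 := by
      have : ‖y‖ / ρ ≤ 0 := by rw [hM0] at hMge; exact_mod_cast hMge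
      have : ‖y‖ ≤ 0 := by rwa [div_le_iff₀ hρ, zero_mul] at this
      exact norm_le_zero_iff.1 this
    rw [hy, sub_self, abs_zero]
    positivity
  -- the chain `z k = (k/M) y`
  set z : ℕ → (EuclideanSpace ℝ (Fin 3)) := fun k => ((k : ℝ) / M) • y with hz
  have hMr : (0 : ℝ) < M := by exact_mod_cast hMpos
  have hstep : ∀ k, ‖z (k + 1) - z k‖ ≤ ρ := fun k => by
    have : z (k + 1) - z k = ((1 : ℝ) / M) • y := by
      simp only [hz, ← sub_smul]; congr 1; push_cast; field_simp; ring
    rw [this, norm_smul, Real.norm_eq_abs, abs_of_nonneg (by positivity), one_div, inv_mul_le_iff₀ hMr]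
    calc ‖y‖ = ‖y‖ / ρ * ρ := by field_simp
      _ ≤ M * ρ := by gcongr
  have hnorm : ∀ k ≤ M, ‖z k‖ ≤ ‖y‖ := fun k hk => by
    simp only [hz, norm_smul, Real.norm_eq_abs, abs_of_nonneg (by positivity : (0 : ℝ) ≤ k / M)]
    have : (k : ℝ) / M ≤ 1 := by rw [div_le_one hMr]; exact_mod_cast hk
    exact mul_le_of_le_one_left (norm_nonneg _) this
  have hind : ∀ k ≤ M, |f (z k) - f 0| ≤ k * (K * (1 + ‖y‖) ^ n) := by
    intro k
    induction k with
    | zero => intro _; simp [hz]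
    | succ k ih =>
      intro hk
      have hk' : k ≤ M := Nat.le_of_succ_le hk
      have h1 := ih hk'
      have h2 := h (z k) (z (k + 1)) (hstep k)
      have h3 : K * (1 + ‖z k‖) ^ n ≤ K * (1 + ‖y‖) ^ n := by
        gcongr; exact hnorm k hk'
      have htri : |f (z (k + 1)) - f 0| ≤ |f (z (k + 1)) - f (z k)| + |f (z k) - f 0| := by
        have := abs_add_le (f (z (k + 1)) - f (z k)) (f (z k) - f 0)
        rwa [sub_add_sub_cancel] at this
      push_cast
      linarith
  have hzM : z M = y := by simp [hz, div_self hMr.ne']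
  have := hind M le_rfl
  rw [hzM] at this
  calc |f y - f 0| ≤ M * (K * (1 + ‖y‖) ^ n) := this
    _ ≤ (‖y‖ / ρ + 1) * (K * (1 + ‖y‖) ^ n) := by gcongr
    _ = (‖y‖ / ρ + 1) * K * (1 + ‖y‖) ^ n := by ring

/-- **From polynomial growth of the increments to `|f(y)| ≤ C |y|^{n+1}` for `|y| ≥ 1`.** [folklore] -/
theorem exists_abs_le_mul_pow_of_increments {f : (EuclideanSpace ℝ (Fin 3)) → ℝ} {ρ K : ℝ} (hρ : 0 < ρ) (hK : 0 ≤ K) {n : ℕ}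
    (h : ∀ y : (EuclideanSpace ℝ (Fin 3)), |f y - f 0| ≤ (‖y‖ / ρ + 1) * K * (1 + ‖y‖) ^ n) :
    ∃ C : ℝ, ∀ y : (EuclideanSpace ℝ (Fin 3)), 1 ≤ ‖y‖ → |f y| ≤ C * ‖y‖ ^ (n + 1) := by
  refine ⟨|f 0| + (1 / ρ + 1) * K * 2 ^ n, fun y hy => ?_⟩
  have hy0 : 0 ≤ ‖y‖ := norm_nonneg _
  have h1 : |f y| ≤ |f 0| + (‖y‖ / ρ + 1) * K * (1 + ‖y‖) ^ n := by
    have := h y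
    have := abs_sub_abs_le_abs_sub (f y) (f 0)
    linarith
  have h2 : (1 + ‖y‖) ^ n ≤ 2 ^ n * ‖y‖ ^ n := by
    rw [← mul_pow]; exact pow_le_pow_left₀ (by positivity) (by linarith) n
  have h3 : ‖y‖ / ρ + 1 ≤ (1 / ρ + 1) * ‖y‖ := by
    rw [add_mul, one_div, inv_mul_eq_div]; gcongr; linarith
  have h4 : |f 0| ≤ |f 0| * ‖y‖ ^ (n + 1) :=
    le_mul_of_one_le_right (abs_nonneg _) (one_le_pow₀ hy)
  have h5 : (‖y‖ / ρ + 1) * K * (1 + ‖y‖) ^ n ≤ (1 / ρ + 1) * K * 2 ^ n * ‖y‖ ^ (n + 1) := by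
    calc (‖y‖ / ρ + 1) * K * (1 + ‖y‖) ^ n ≤ ((1 / ρ + 1) * ‖y‖) * K * (2 ^ n * ‖y‖ ^ n) := by
          gcongr
      _ = (1 / ρ + 1) * K * 2 ^ n * ‖y‖ ^ (n + 1) := by rw [pow_succ]; ring
  calc |f y| ≤ |f 0| + (‖y‖ / ρ + 1) * K * (1 + ‖y‖) ^ n := h1
    _ ≤ |f 0| * ‖y‖ ^ (n + 1) + (1 / ρ + 1) * K * 2 ^ n * ‖y‖ ^ (n + 1) := add_le_add h4 h5
    _ = (|f 0| + (1 / ρ + 1) * K * 2 ^ n) * ‖y‖ ^ (n + 1) := by ring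

/-! ### The local pressure inputs, for `3 ≤ q ≤ ∞` -/

/-- `‖|θU|²‖_{L^{q/2}} ≤ ‖U‖²_{L^q}` for the localised field. [folklore] -/
theorem eLpNorm_norm_locF_sq_le {U : (EuclideanSpace ℝ (Fin 3)) → (EuclideanSpace ℝ (Fin 3))} (q : ℝ≥0∞) (ρ : ℝ) (x₀ : (EuclideanSpace ℝ (Fin 3))) :
    eLpNorm (fun y => ‖(fun w : (EuclideanSpace ℝ (Fin 3)) => cutoff (4 * ρ) (w - x₀) • U w) y‖ ^ 2) (q / 2) volume ≤
      eLpNorm U q volume ^ (2 : ℝ) := by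
  have h := eLpNorm_norm_rpow (fun w : (EuclideanSpace ℝ (Fin 3)) => cutoff (4 * ρ) (w - x₀) • U w) (p := q / 2) (μ := volume)
    (q := 2) two_pos
  have hq' : q / 2 * ENNReal.ofReal 2 = q := by
    rw [ENNReal.ofReal_ofNat, ENNReal.div_mul_cancel two_ne_zero ENNReal.ofNat_ne_top]
  rw [hq'] at h
  have e : eLpNorm (fun y => ‖(fun w : (EuclideanSpace ℝ (Fin 3)) => cutoff (4 * ρ) (w - x₀) • U w) y‖ ^ 2) (q / 2) volume =
      eLpNorm (fun w : (EuclideanSpace ℝ (Fin 3)) => cutoff (4 * ρ) (w - x₀) • U w) q volume ^ (2 : ℝ) := by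
    rw [← h]; refine eLpNorm_congr_ae (Eventually.of_forall fun w => ?_); simp
  rw [e]
  exact ENNReal.rpow_le_rpow (eLpNorm_mono fun y => norm_locF_le y) zero_le_two

/-- **Local pressure inputs for `3 ≤ q ≤ ∞`.** For a Leray profile with `U ∈ C^∞ ∩ L^q((EuclideanSpace ℝ (Fin 3)))`,
`3 ≤ q ≤ ∞`, `ν > 0`, `a > 0`, and — when `q < 4` — Stein's `L^p` bound for the normalised pressure,
for every radius `ρ > 0` there is `K` such that for every centre `x₀`:
`‖∇(P − p̃[θ_{x₀,ρ}U])‖ ≤ K(1 + |x₀|)` on `B̄(x₀, ρ)` and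
`‖P − c_{x₀}‖_{L^{3/2}(B(x₀,ρ))} ≤ K(1 + |x₀|)`, `c_{x₀} = (P − p̃[θ_{x₀,ρ}U])(x₀)` (for `q ≥ 4` from
the tree's `L²` bound of `p̃`, otherwise with `p = q/2` from the Stein fact; then Hölder down to
`3/2`). [cite: Tsai1998, Lemma 2.1 and (2.3)–(2.4)] -/
theorem IsLerayProfile.exists_local_pressure_inputs (hprof : IsLerayProfile ν a U P) (hU : ContDiff ℝ ∞ U)
    (hν : 0 < ν) (ha : 0 < a) {q : ℝ≥0∞} (hq : 3 ≤ q) (hUq : MemLp U q volume)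
    (hSteinq : 4 ≤ q ∨ stein1970_normalisedPressure_Lp_bound) {ρ : ℝ} (hρ : 0 < ρ) :
    ∃ K : ℝ, 0 ≤ K ∧ ∀ x₀ : (EuclideanSpace ℝ (Fin 3)),
      (∀ y ∈ closedBall x₀ ρ, ‖fderiv ℝ (fun x => P x - normalisedPressure
        (fun w : (EuclideanSpace ℝ (Fin 3)) => cutoff (4 * ρ) (w - x₀) • U w) x) y‖ ≤ K * (1 + ‖x₀‖)) ∧
      eLpNorm (fun x => P x - (P x₀ - normalisedPressure (fun w : (EuclideanSpace ℝ (Fin 3)) => cutoff (4 * ρ) (w - x₀) • U w) x₀))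
        (ENNReal.ofReal (3 / 2)) (volume.restrict (ball x₀ ρ)) ≤ ENNReal.ofReal (K * (1 + ‖x₀‖)) := by
  have hUc : Continuous U := hU.continuous
  have hP1 : ContDiff ℝ 1 P := (hprof.contDiff_two_pressure (hU.of_le (by norm_cast))).of_le one_le_two
  have h32one : (1 : ℝ≥0∞) ≤ ENNReal.ofReal (3 / 2) := by
    rw [← ENNReal.ofReal_one]; exact ENNReal.ofReal_le_ofReal (by norm_num)
  -- Step 1: an `L^p` bound for some `p ≥ 3/2`
  have key : ∃ p : ℝ≥0∞, ENNReal.ofReal (3 / 2) ≤ p ∧ ∃ K₀ : ℝ, 0 ≤ K₀ ∧ ∀ x₀ : (EuclideanSpace ℝ (Fin 3)),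
      (∀ y ∈ closedBall x₀ ρ, ‖fderiv ℝ (fun x => P x - normalisedPressure
        (fun w : (EuclideanSpace ℝ (Fin 3)) => cutoff (4 * ρ) (w - x₀) • U w) x) y‖ ≤ K₀ * (1 + ‖x₀‖)) ∧
      eLpNorm (fun x => P x - (P x₀ - normalisedPressure (fun w : (EuclideanSpace ℝ (Fin 3)) => cutoff (4 * ρ) (w - x₀) • U w) x₀))
        p (volume.restrict (ball x₀ ρ)) ≤ ENNReal.ofReal (K₀ * (1 + ‖x₀‖)) := by
    by_cases hq4 : 4 ≤ q
    · obtain ⟨K₀, hK₀, h⟩ := hprof.exists_local_pressure_bound_of_four_le hU hν.le ha.le hρ hq4 hUq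
      refine ⟨2, ?_, K₀, hK₀, h⟩
      rw [← ENNReal.ofReal_ofNat]; exact ENNReal.ofReal_le_ofReal (by norm_num)
    · have hStein : stein1970_normalisedPressure_Lp_bound := hSteinq.resolve_left hq4
      have hqlt : q < 4 := not_le.1 hq4
      have hqtop : q < ⊤ := hqlt.trans (by norm_num)
      have hp1 : (1 : ℝ≥0∞) < q / 2 := by
        rw [ENNReal.lt_div_iff_mul_lt (Or.inl two_ne_zero) (Or.inl ENNReal.ofNat_ne_top), one_mul]
        exact lt_of_lt_of_le (by norm_num) hq
      have hptop : q / 2 < ⊤ := ENNReal.div_lt_top hqtop.ne two_ne_zero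
      obtain ⟨C, hC⟩ := hStein (q / 2) hp1 hptop
      -- the uniform `L^{q/2}` bound on the localised normalised pressures
      obtain ⟨MU, hMU0, hMUq⟩ : ∃ MU : ℝ, 0 ≤ MU ∧ eLpNorm U q volume ≤ ENNReal.ofReal MU :=
        ⟨(eLpNorm U q volume).toReal, ENNReal.toReal_nonneg, (ENNReal.ofReal_toReal hUq.eLpNorm_ne_top).ge⟩
      set B : ℝ := C * MU ^ 2 with hB
      have hN : ∀ x₀ : (EuclideanSpace ℝ (Fin 3)), eLpNorm (normalisedPressure (fun w : (EuclideanSpace ℝ (Fin 3)) => cutoff (4 * ρ) (w - x₀) • U w)) (q / 2) volume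
          ≤ ENNReal.ofReal B := fun x₀ => by
        have h1 := hC (fun w : (EuclideanSpace ℝ (Fin 3)) => cutoff (4 * ρ) (w - x₀) • U w) (contDiff_locF hU) (hasCompactSupport_locF hρ)
        refine h1.trans ?_
        calc (C : ℝ≥0∞) * eLpNorm (fun y => ‖(fun w : (EuclideanSpace ℝ (Fin 3)) => cutoff (4 * ρ) (w - x₀) • U w) y‖ ^ 2) (q / 2) volume
            ≤ (C : ℝ≥0∞) * (ENNReal.ofReal MU ^ (2 : ℝ)) := by
              gcongr
              exact (eLpNorm_norm_locF_sq_le q ρ x₀).trans (ENNReal.rpow_le_rpow hMUq zero_le_two)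
          _ = ENNReal.ofReal B := by
              rw [hB, ENNReal.ofReal_rpow_of_nonneg hMU0 zero_le_two, Real.rpow_two, ← ENNReal.ofReal_coe_nnreal,
                ← ENNReal.ofReal_mul (by positivity)]
      obtain ⟨K₀, hK₀, h⟩ := hprof.exists_local_pressure_bound hU hν.le ha.le hρ (le_trans (by norm_num) hq) hUq
        hp1.le (by positivity : 0 ≤ B) hN
      refine ⟨q / 2, ?_, K₀, hK₀, h⟩
      rw [ENNReal.le_div_iff_mul_le (Or.inl two_ne_zero) (Or.inl ENNReal.ofNat_ne_top), ofReal_three_halves,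
        ENNReal.div_mul_cancel two_ne_zero ENNReal.ofNat_ne_top]
      exact hq
  -- Step 2: Hölder down to `3/2`
  obtain ⟨p, hp32, K₀, hK₀, hmain⟩ := key
  set V : ℝ≥0∞ := (volume (ball (0 : (EuclideanSpace ℝ (Fin 3))) ρ)) ^ (1 / (ENNReal.ofReal (3 / 2)).toReal - 1 / p.toReal) with hV
  have hVlt : V < ⊤ := volume_ball_rpow_lt_top ρ (one_div_toReal_sub_nonneg h32one hp32)
  refine ⟨max K₀ (V.toReal * K₀), le_max_of_le_left hK₀, fun x₀ => ⟨fun y hy => ?_, ?_⟩⟩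
  · exact ((hmain x₀).1 y hy).trans (mul_le_mul_of_nonneg_right (le_max_left _ _) (by positivity))
  · have hmeas : AEStronglyMeasurable (fun x => P x - (P x₀ - normalisedPressure
        (fun w : (EuclideanSpace ℝ (Fin 3)) => cutoff (4 * ρ) (w - x₀) • U w) x₀)) volume :=
      (hP1.continuous.sub continuous_const).aestronglyMeasurable
    calc eLpNorm (fun x => P x - (P x₀ - normalisedPressure (fun w : (EuclideanSpace ℝ (Fin 3)) => cutoff (4 * ρ) (w - x₀) • U w) x₀))
          (ENNReal.ofReal (3 / 2)) (volume.restrict (ball x₀ ρ))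
        ≤ eLpNorm (fun x => P x - (P x₀ - normalisedPressure (fun w : (EuclideanSpace ℝ (Fin 3)) => cutoff (4 * ρ) (w - x₀) • U w) x₀))
            p (volume.restrict (ball x₀ ρ)) * V := eLpNorm_ball_le_mul_eLpNorm hmeas hp32 x₀ ρ
      _ ≤ ENNReal.ofReal (K₀ * (1 + ‖x₀‖)) * V := by gcongr; exact (hmain x₀).2
      _ = ENNReal.ofReal ((V.toReal * K₀) * (1 + ‖x₀‖) ^ 1) := by
          rw [mul_comm, pow_one]
          have := const_mul_ofReal_poly hVlt.ne K₀ ‖x₀‖ 1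
          rwa [pow_one] at this
      _ ≤ ENNReal.ofReal (max K₀ (V.toReal * K₀) * (1 + ‖x₀‖)) := by
          rw [pow_one]; exact ENNReal.ofReal_le_ofReal (mul_le_mul_of_nonneg_right (le_max_right _ _) (by positivity))

/-! ### Oscillation of the pressure on unit balls -/

/-- **`osc_{B̄(x₀,1)} P ≤ K (1 + |x₀|)⁶`** for a Leray profile with `U ∈ C^∞ ∩ L^q((EuclideanSpace ℝ (Fin 3)))`, `3 ≤ q ≤ ∞`,
`ν, a > 0`, given the interior Stokes estimate and (for `q < 4`) Stein's bound (Tsai 1998, §3.2: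
"`osc(P, B_{1/8}) = o(|y₀|⁴)`"; here from `P = h + p̃[θU]` on `B(x₀, 4)`, `|∇h| ≤ K(1+|x₀|)` and
`|p̃[θU]| ≤ K(1+|x₀|)⁶` by the bootstrap). [cite: Tsai1998, Lemma 3.2 (pp. 38–39)] -/
theorem IsLerayProfile.exists_osc_pressure_le (hSt : stokes_interior_Lr_estimate)
    (hprof : IsLerayProfile ν a U P) (hU : ContDiff ℝ ∞ U) (hν : 0 < ν) (ha : 0 < a) {q : ℝ≥0∞}
    (hq : 3 ≤ q) (hUq : MemLp U q volume) (hSteinq : 4 ≤ q ∨ stein1970_normalisedPressure_Lp_bound) :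
    ∃ K : ℝ, 0 ≤ K ∧ ∀ x₀ x : (EuclideanSpace ℝ (Fin 3)), ‖x - x₀‖ ≤ 1 → |P x - P x₀| ≤ K * (1 + ‖x₀‖) ^ 6 := by
  have hUc : Continuous U := hU.continuous
  have hP2 : ContDiff ℝ 2 P := hprof.contDiff_two_pressure (hU.of_le (by norm_cast))
  -- gradient bound at radius `1`, pressure input at radius `9000`
  obtain ⟨KG, hKG, hG⟩ := hprof.exists_local_pressure_inputs hU hν ha hq hUq hSteinq one_pos
  obtain ⟨KP, hKP, hP⟩ := hprof.exists_local_pressure_inputs hU hν ha hq hUq hSteinq (by norm_num : (0 : ℝ) < 9000)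
  set c : (EuclideanSpace ℝ (Fin 3)) → ℝ := fun x₀ => P x₀ - normalisedPressure (fun w : (EuclideanSpace ℝ (Fin 3)) => cutoff (4 * 9000) (w - x₀) • U w) x₀ with hc
  have hPc : ∀ x₀ : (EuclideanSpace ℝ (Fin 3)), eLpNorm (fun x => P x - c x₀) (ENNReal.ofReal (3 / 2))
      (volume.restrict (ball x₀ (1000 * 9))) ≤ ENNReal.ofReal (KP * (1 + ‖x₀‖)) := fun x₀ => by
    rw [show (1000 : ℝ) * 9 = 9000 by norm_num]; exact (hP x₀).2
  -- the bootstrap with `R = 9`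
  obtain ⟨KB, hKB, hB⟩ := hprof.bootstrap hSt hU hν ha.le hq hUq (by norm_num : (0 : ℝ) < 9) hKP hPc
  obtain ⟨CU2, hCU20, hCU2⟩ := exists_eLpNorm_restrict_ball_le_of_memLp hUc hUq (s := 2) (by norm_num)
    (le_trans (by norm_num) hq) (9 * 1)
  have e81 : (9 : ℝ) * 9 = 81 := by norm_num
  have hD2 : ∀ x₀ : (EuclideanSpace ℝ (Fin 3)), eLpNorm (fun x => iteratedFDeriv ℝ 2 U x) 2 (volume.restrict (ball x₀ (9 * 1))) ≤
      ENNReal.ofReal (max KB CU2 * (1 + ‖x₀‖) ^ 3) := fun x₀ =>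
    ((eLpNorm_restrict_ball_mono _ _ x₀ (by norm_num)).trans (hB x₀).2.2.1).trans
      (ENNReal.ofReal_le_ofReal (by gcongr; exact le_max_left _ _))
  have hD6 : ∀ x₀ : (EuclideanSpace ℝ (Fin 3)), eLpNorm (fun x => fderiv ℝ U x) 6 (volume.restrict (ball x₀ (9 * 1))) ≤
      ENNReal.ofReal (max KB CU2 * (1 + ‖x₀‖) ^ 3) := fun x₀ =>
    ((eLpNorm_restrict_ball_mono _ _ x₀ (by norm_num)).trans (hB x₀).2.2.2.1).trans
      (ENNReal.ofReal_le_ofReal (by gcongr; exact le_max_left _ _))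
  have hU12 : ∀ x₀ : (EuclideanSpace ℝ (Fin 3)), eLpNorm U 12 (volume.restrict (ball x₀ (9 * 1))) ≤ ENNReal.ofReal (max KB CU2 * (1 + ‖x₀‖) ^ 3) :=
    fun x₀ => ((eLpNorm_restrict_ball_mono _ _ x₀ (by norm_num)).trans (hB x₀).2.2.2.2).trans
      (ENNReal.ofReal_le_ofReal (by gcongr; exact le_max_left _ _))
  have hD2' : ∀ x₀ : (EuclideanSpace ℝ (Fin 3)), eLpNorm (fun x => fderiv ℝ U x) 2 (volume.restrict (ball x₀ (9 * 1))) ≤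
      ENNReal.ofReal (max KB CU2 * (1 + ‖x₀‖) ^ 3) := fun x₀ =>
    ((eLpNorm_restrict_ball_mono _ _ x₀ (by norm_num)).trans (hB x₀).1).trans
      (ENNReal.ofReal_le_ofReal (by gcongr; exact le_max_left _ _))
  have hU2 : ∀ x₀ : (EuclideanSpace ℝ (Fin 3)), eLpNorm U 2 (volume.restrict (ball x₀ (9 * 1))) ≤ ENNReal.ofReal (max KB CU2 * (1 + ‖x₀‖) ^ 3) :=
    fun x₀ => (poly_zero_of_uniform hCU2 3 hCU20 x₀).trans
      (ENNReal.ofReal_le_ofReal (by gcongr; exact le_max_right _ _))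
  obtain ⟨KN, hKN, hN⟩ := exists_poly_bound_sup_localPressure hU one_pos (le_max_of_le_left hKB) hD2 hD6 hU12 hD2' hU2
  -- the oscillation
  refine ⟨KG + 2 * KN, by positivity, fun x₀ x hx => ?_⟩
  have ht : 0 ≤ ‖x₀‖ := norm_nonneg _
  set N : (EuclideanSpace ℝ (Fin 3)) → ℝ := normalisedPressure (fun w : (EuclideanSpace ℝ (Fin 3)) => cutoff (4 * 1) (w - x₀) • U w) with hNd
  have hN2 : ContDiff ℝ 2 N := contDiff_normalisedPressure_locF hU one_pos (x₀ := x₀)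
  have hh1 : ContDiff ℝ 1 (fun y => P y - N y) := (hP2.sub hN2).of_le one_le_two
  have hxmem : x ∈ closedBall x₀ 1 := by rwa [mem_closedBall, dist_eq_norm]
  have hmv : |(P x - N x) - (P x₀ - N x₀)| ≤ KG * (1 + ‖x₀‖) := by
    have h := (convex_closedBall x₀ 1).norm_image_sub_le_of_norm_fderiv_le (f := fun y => P y - N y)
      (fun z _ => (hh1.differentiable one_ne_zero z)) (hG x₀).1 (mem_closedBall_self zero_le_one) hxmem
    rw [Real.norm_eq_abs] at h
    refine h.trans ?_
    calc KG * (1 + ‖x₀‖) * ‖x - x₀‖ ≤ KG * (1 + ‖x₀‖) * 1 := by gcongr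
      _ = KG * (1 + ‖x₀‖) := mul_one _
  have hNx := hN x₀ x
  have hNx₀ := hN x₀ x₀
  have h16 : (1 + ‖x₀‖) ≤ (1 + ‖x₀‖) ^ 6 := le_self_pow₀ (by linarith) (by norm_num)
  have hsplit : P x - P x₀ = ((P x - N x) - (P x₀ - N x₀)) + (N x - N x₀) := by ring
  rw [hsplit]
  calc |((P x - N x) - (P x₀ - N x₀)) + (N x - N x₀)|
      ≤ |(P x - N x) - (P x₀ - N x₀)| + |N x - N x₀| := abs_add_le _ _
    _ ≤ KG * (1 + ‖x₀‖) + (|N x| + |N x₀|) := add_le_add hmv (abs_sub _ _)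
    _ ≤ KG * (1 + ‖x₀‖) ^ 6 + (KN * (1 + ‖x₀‖) ^ (3 + 3) + KN * (1 + ‖x₀‖) ^ (3 + 3)) := by
        gcongr
    _ = (KG + 2 * KN) * (1 + ‖x₀‖) ^ 6 := by ring

/-! ### Lemma 3.2 -/

/-- **Tsai 1998, Lemma 3.2, for a single profile**: under the hypotheses of
`IsLerayProfile.exists_osc_pressure_le`, `|P(y)| ≤ C |y|⁷` for `|y| ≥ 1`. [cite: Tsai1998, Lemma 3.2 (p. 39)] -/
theorem IsLerayProfile.exists_pressure_growth (hSt : stokes_interior_Lr_estimate)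
    (hprof : IsLerayProfile ν a U P) (hU : ContDiff ℝ ∞ U) (hν : 0 < ν) (ha : 0 < a) {q : ℝ≥0∞}
    (hq : 3 ≤ q) (hUq : MemLp U q volume) (hSteinq : 4 ≤ q ∨ stein1970_normalisedPressure_Lp_bound) :
    ∃ (N : ℕ) (C R : ℝ), ∀ y : (EuclideanSpace ℝ (Fin 3)), R ≤ ‖y‖ → |P y| ≤ C * ‖y‖ ^ N := by
  obtain ⟨K, hK, hosc⟩ := hprof.exists_osc_pressure_le hSt hU hν ha hq hUq hSteinq
  have hincr := abs_sub_le_of_osc_le (f := P) one_pos hK (n := 6) (fun x₀ x hx => hosc x₀ x hx)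
  simp only [div_one] at hincr
  obtain ⟨C, hC⟩ := exists_abs_le_mul_pow_of_increments (f := P) one_pos hK (n := 6)
    (fun y => by have := hincr y; rwa [div_one])
  exact ⟨7, C, 1, hC⟩

/-- **Tsai 1998, Lemma 3.2, from the two named facts and the regularity of weak solutions**:
`tsai1998_profile_smooth → stokes_interior_Lr_estimate → stein1970_normalisedPressure_Lp_bound →
tsai1998_lemma32`. The Stein fact is used only for `3 ≤ q < 4`. [cite: Tsai1998, Lemma 3.2 (p. 39)] -/
theorem tsai1998_lemma32_of_facts (hreg : tsai1998_profile_smooth) (hSt : stokes_interior_Lr_estimate)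
    (hStein : stein1970_normalisedPressure_Lp_bound) : tsai1998_lemma32 := by
  intro ν a hν ha U P hprof q hq hUq
  exact hprof.exists_pressure_growth hSt (hreg hν ha hprof) hν ha hq hUq (Or.inr hStein)

/-- **Tsai 1998, Lemma 3.2 for `4 ≤ q ≤ ∞`, from the Stokes estimate alone** (the `L²` theory of
the normalised pressure being proved in the tree): for `ν, a > 0`, a Leray profile with
`U ∈ L^q((EuclideanSpace ℝ (Fin 3)))`, `4 ≤ q ≤ ∞`, has `|P(y)| ≤ C|y|^N` for `|y| ≥ R`. [cite: Tsai1998, Lemma 3.2 (p. 39)] -/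
theorem tsai1998_lemma32_restricted_of_stokes (hreg : tsai1998_profile_smooth)
    (hSt : stokes_interior_Lr_estimate) {ν a : ℝ} (hν : 0 < ν) (ha : 0 < a) {U : (EuclideanSpace ℝ (Fin 3)) → (EuclideanSpace ℝ (Fin 3))} {P : (EuclideanSpace ℝ (Fin 3)) → ℝ}
    (hprof : IsLerayProfile ν a U P) {q : ℝ≥0∞} (hq : 4 ≤ q) (hUq : MemLp U q volume) :
    ∃ (N : ℕ) (C R : ℝ), ∀ y : (EuclideanSpace ℝ (Fin 3)), R ≤ ‖y‖ → |P y| ≤ C * ‖y‖ ^ N :=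
  hprof.exists_pressure_growth hSt (hreg hν ha hprof) hν ha (le_trans (by norm_num) hq) hUq (Or.inl hq)

end Growth

end Literature.Analysis.FluidPDE

end
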